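import Summits.AnomalousDissipation.AnomalousDissipation.Theorems.SolenoidalFractalHomogenisationLagrangianStepVmodConstMode
import Summits.AnomalousDissipation.AnomalousDissipation.Theorems.SolenoidalFractalHomogenisationLagrangianStepVmodCoarseLoss
import Summits.AnomalousDissipation.AnomalousDissipation.Theorems.SolenoidalFractalHomogenisationLagrangianStepCellGridProjection
import Literature.Analysis.FluidPDE.PassiveVectorTensorOffBallDecay
import Literature.Analysis.FluidPDE.PassiveVectorTensorPropagatorSector
import HarnessLib

/-!
# K1L_D (stmt-AnomalousDissipation-27980): (V_mod) flat stage, block (ff) — part (i): FAST DATA CARRIED BY BLOCH CLASSES WITHOUT A SLOW MEMBER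
(line file of the (V_mod) lane, block (ff) = `VmodFlat.Bff_textEVH` (tenure D27-12); prover ad-k3l-bookkeeping-p1 g9.)

Cell units of `VmodFlat.BlockBound`: resolution `n ≥ 1`, cell carrier `cellField W M hM ν _ n` (`1/n`-periodic), cell member `U`
(tensor `(1/n²)•𝔸`), coarse member `T` (no drift).  A frequency `k` HAS A SLOW MATE when its Bloch class `k + nℤ³` meets the slow ball
`freqBall (n/4)` (`∃ ℓ₀ ∈ freqBall (n/4), n ∣ k − ℓ₀` componentwise); the classes WITHOUT a slow mate consist of fast modes only.  Along the
`1/n`-periodic carrier the cell propagator preserves every union of Bloch classes (`IsPropagator.mFourierCoeff_apply_eq_zero_of_multiplier`,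
this seat's `Literature/…/PassiveVectorTensorPropagatorSector`), in particular the two complementary symmetric unions «classes with a slow mate»
/ «classes without»; the grid multiplier of the slow block `freqBall (n/4)` (`gridMultiplier_eq`: the number of slow mates, `0` or `1`) separates them.
* §1 the slow block is SMALL (`2|ℓᵢ| < n`), so every class has at most one slow mate, and a slow label is its own slow mate;
* §2 `fc_cell_apply_eq_zero_of_noSlowMate` / `fc_cell_apply_eq_zero_of_slowMate` — the cell propagator keeps data inside either union at EVERY time;
* §3 **`norm_sq_cell_apply_le_exp_of_noSlowMate`** — data carried by classes without a slow mate are DAMPED by the cell propagator: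
  `‖U s t x‖² ≤ exp(−8π²·lo′·⌊n/4⌋²·(t − s))·‖x‖²`, `lo′` the lower ellipticity constant of `(1/n²)•𝔸` (`IsPropagator.norm_sq_apply_le_exp_of_multiplier`,
  this seat's `Literature/…/PassiveVectorTensorOffBallDecay`; in the clause's regime `lo′ = ν·lo/(λn²)`, i.e. rate `(π²/2)·(lo/Λ)·ν` per cell time,
  `= (π²/2)(lo/Λ)·M·W.period` per period `P = M·W.period/ν` — ν-FREE per period);
* §4 **`ff_noSlowMate_pairing_le`** — the (ff) pairing on such data in loss currency: for fast `ζ` and `x` carried by classes without a slow mate,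
  `|⟪U s t x − T s t x, ζ⟫| ≤ ((e^{−a(t−s)/2} + e^{−r(t−s)/2})/(1 − e^{−r(t−s)}))·√(lossFwd (T s t) x)·√(lossAdj (T s t) ζ)` with `a = 8π²lo′_U⌊n/4⌋²`,
  `r = 8π²lo′_T⌊n/4⌋²` (`lossFwd_ge_of_supp` / `lossAdj_ge_of_supp` of `…VmodCoarseLoss` for the coarse member, §3 for the cell member).
This is the input-free part of (ff) (finding F-k3l9-1 / certifier memo v3: classes WITH a slow mate consume (V) resp. W7).  `sorry`-free; NOT a proof
of (ff), of the stub, of K1L_D or AD; rung F-D1.A0.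
-/

set_option linter.dupNamespace false

noncomputable section

namespace Summit.AnomalousDissipation.AnomalousDissipation.Theorems.SolenoidalFractalHomogenisation.LagrangianStep.VmodFlat

open Literature.Analysis Literature.Analysis.FluidPDE Literature.Analysis.FunctionSpaces
open MeasureTheory Set Filter UnitAddTorus
open scoped ENNReal NNReal InnerProductSpace
open Summit.AnomalousDissipation.AnomalousDissipation.Theorems.SolenoidalFractalHomogenisation.LagrangianStep.CellClauseMod
open Summit.AnomalousDissipation.AnomalousDissipation.Theorems.SolenoidalFractalHomogenisation.LagrangianStep.LossCurrency
open Summit.AnomalousDissipation.AnomalousDissipation.Theorems.SolenoidalFractalHomogenisation.RealisedQuasiStaticCellLaw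
  (isSmooth_cell isDivFree_cell memLp_top_stLift_cell)

/-! ## §1 The slow block is small; slow mates -/

/-- A slow label has small coordinates: `ℓ ∈ freqBall (n/4)` gives `2|ℓᵢ| < n` (`n ≥ 1`). [folklore] -/
theorem two_mul_abs_lt_of_mem_slowBall {n : ℕ} (hn : 0 < n) {ℓ : Fin 3 → ℤ} (hℓ : ℓ ∈ Torus.freqBall (d := Fin 3) (n / 4)) (i : Fin 3) :
    2 * |ℓ i| < n := by
  have h1 : Torus.freqNormSq ℓ ≤ ((n / 4 : ℕ) : ℝ) ^ 2 := Torus.mem_freqBall.1 hℓ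
  have h2 : ((ℓ i : ℝ)) ^ 2 ≤ Torus.freqNormSq ℓ := by
    rw [Torus.freqNormSq]
    exact Finset.single_le_sum (f := fun j => ((ℓ j : ℝ)) ^ 2) (fun j _ => sq_nonneg _) (Finset.mem_univ i)
  have h3 : ((n / 4 : ℕ) : ℝ) ≤ (n : ℝ) / 4 := Nat.cast_div_le
  have h4 : |((ℓ i : ℝ))| ≤ (n : ℝ) / 4 := by
    have : ((ℓ i : ℝ)) ^ 2 ≤ ((n : ℝ) / 4) ^ 2 := (h2.trans h1).trans (pow_le_pow_left₀ (Nat.cast_nonneg _) h3 2)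
    exact abs_le_of_sq_le_sq' this (by positivity) |> fun h => abs_le.2 h
  have h5 : (2 : ℝ) * |((ℓ i : ℝ))| < n := by
    have hn' : (0 : ℝ) < n := by exact_mod_cast hn
    linarith
  exact_mod_cast h5

/-- Every member of the slow block is small in every coordinate. [folklore] -/
theorem slowBall_small {n : ℕ} (hn : 0 < n) : ∀ ℓ₀ ∈ Torus.freqBall (d := Fin 3) (n / 4), ∀ i, 2 * |ℓ₀ i| < n :=
  fun _ hℓ i => two_mul_abs_lt_of_mem_slowBall hn hℓ i

/-- A slow label is its own slow mate. [folklore] -/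
theorem slowMate_of_mem_slowBall {n : ℕ} {k : Fin 3 → ℤ} (hk : k ∈ Torus.freqBall (d := Fin 3) (n / 4)) :
    ∃ ℓ₀ ∈ Torus.freqBall (d := Fin 3) (n / 4), ∀ i, (n : ℤ) ∣ k i - ℓ₀ i :=
  ⟨k, hk, fun i => by rw [sub_self]; exact dvd_zero _⟩

open Classical in
/-- The number of slow mates of a frequency is `0` or `1`; it is `0` iff there is no slow mate. [folklore] -/
theorem card_slowMates_eq {n : ℕ} (hn : 0 < n) (k : Fin 3 → ℤ) :
    ((Torus.freqBall (d := Fin 3) (n / 4)).filter fun ℓ₀ => ∀ i, (n : ℤ) ∣ k i - ℓ₀ i).card =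
      if (∃ ℓ₀ ∈ Torus.freqBall (d := Fin 3) (n / 4), ∀ i, (n : ℤ) ∣ k i - ℓ₀ i) then 1 else 0 := by
  split_ifs with h
  · obtain ⟨ℓ₀, hℓ₀, hdvd⟩ := h
    refine le_antisymm (card_filter_dvd_sub_le_one _ (slowBall_small hn) k) ?_
    exact Finset.card_pos.2 ⟨ℓ₀, Finset.mem_filter.2 ⟨hℓ₀, hdvd⟩⟩
  · rw [Finset.card_eq_zero, Finset.filter_eq_empty_iff]
    intro ℓ₀ hℓ₀ hdvd
    exact h ⟨ℓ₀, hℓ₀, hdvd⟩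

/-! ## §2 The cell propagator keeps data inside «classes with / without a slow mate» at every time -/

section Cell

variable {k : ℕ} (W : LatticeShear.LatticeWord k) (M : ℝ) (hM : 0 < M) {ν : ℝ} (hν : 0 < ν) {n : ℕ}
  {𝔸 : Torus.Visc4 (Fin 3)} {lo' hi' Tw : ℝ} {U : ℝ → ℝ → (V2 →L[ℝ] V2)}

/-- The grid multiplier of the slow block counts slow mates: with the weights `c_j = n⁻³ Σ_{ℓ₀ slow} cos(2π ℓ₀·j/n)`,
`Σ_j c_j e_k(x_j) = #slow mates of k ∈ {0, 1}`. [folklore] -/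
theorem slowMultiplier_eq (hn : 0 < n) (k' : Fin 3 → ℤ) :
    (∑ j : Fin 3 → Fin n, (((1 / (n:ℝ) ^ 3 * ∑ ℓ₀ ∈ Torus.freqBall (d := Fin 3) (n / 4),
        Real.cos (2 * Real.pi * (∑ i, (ℓ₀ i : ℝ) * ((j i : ℕ) : ℝ)) / n)) : ℝ) : ℂ) *
        UnitAddTorus.mFourier k' (fun i => ((((j i : ℕ) : ℝ) / n : ℝ) : UnitAddCircle))) =
      if (∃ ℓ₀ ∈ Torus.freqBall (d := Fin 3) (n / 4), ∀ i, (n : ℤ) ∣ k' i - ℓ₀ i) then (1 : ℂ) else 0 := by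
  classical
  rw [gridMultiplier_eq hn _ Torus.neg_mem_freqBall_of_mem k', card_slowMates_eq hn k']
  split_ifs <;> simp

/-- The complementary weights `δ₀ − c_j` have the multiplier `1 − #slow mates`: `1` exactly on the classes WITHOUT a slow mate. [folklore] -/
theorem noSlowMultiplier_eq (hn : 0 < n) (k' : Fin 3 → ℤ) :
    (∑ j : Fin 3 → Fin n, ((((if j = (fun _ => ⟨0, hn⟩) then (1:ℝ) else 0) -
        (1 / (n:ℝ) ^ 3 * ∑ ℓ₀ ∈ Torus.freqBall (d := Fin 3) (n / 4),
          Real.cos (2 * Real.pi * (∑ i, (ℓ₀ i : ℝ) * ((j i : ℕ) : ℝ)) / n)) : ℝ) : ℂ)) *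
        UnitAddTorus.mFourier k' (fun i => ((((j i : ℕ) : ℝ) / n : ℝ) : UnitAddCircle))) =
      if (∃ ℓ₀ ∈ Torus.freqBall (d := Fin 3) (n / 4), ∀ i, (n : ℤ) ∣ k' i - ℓ₀ i) then (0 : ℂ) else 1 := by
  classical
  have hsplit : ∀ j : Fin 3 → Fin n,
      (((if j = (fun _ => ⟨0, hn⟩) then (1:ℝ) else 0) -
        (1 / (n:ℝ) ^ 3 * ∑ ℓ₀ ∈ Torus.freqBall (d := Fin 3) (n / 4),
          Real.cos (2 * Real.pi * (∑ i, (ℓ₀ i : ℝ) * ((j i : ℕ) : ℝ)) / n)) : ℝ) : ℂ) *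
        UnitAddTorus.mFourier k' (fun i => ((((j i : ℕ) : ℝ) / n : ℝ) : UnitAddCircle)) =
      ((if j = (fun _ => ⟨0, hn⟩) then (1:ℝ) else 0 : ℝ) : ℂ) *
          UnitAddTorus.mFourier k' (fun i => ((((j i : ℕ) : ℝ) / n : ℝ) : UnitAddCircle)) -
        (((1 / (n:ℝ) ^ 3 * ∑ ℓ₀ ∈ Torus.freqBall (d := Fin 3) (n / 4),
          Real.cos (2 * Real.pi * (∑ i, (ℓ₀ i : ℝ) * ((j i : ℕ) : ℝ)) / n)) : ℝ) : ℂ) *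
          UnitAddTorus.mFourier k' (fun i => ((((j i : ℕ) : ℝ) / n : ℝ) : UnitAddCircle)) := by
    intro j; push_cast; ring
  rw [Finset.sum_congr rfl fun j _ => hsplit j, Finset.sum_sub_distrib, slowMultiplier_eq hn k']
  have hδ : (∑ j : Fin 3 → Fin n, ((if j = (fun _ => ⟨0, hn⟩) then (1:ℝ) else 0 : ℝ) : ℂ) *
      UnitAddTorus.mFourier k' (fun i => ((((j i : ℕ) : ℝ) / n : ℝ) : UnitAddCircle))) = 1 := by
    rw [Finset.sum_eq_single (fun _ => (⟨0, hn⟩ : Fin n))]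
    · rw [if_pos rfl, Torus.mFourier_grid]
      simp
    · intro j _ hj
      rw [if_neg hj]; simp
    · intro h; exact absurd (Finset.mem_univ _) h
  rw [hδ]
  split_ifs <;> norm_num

/-- **The cell propagator keeps data carried by classes WITHOUT a slow mate inside those classes, at every time.** [folklore] -/
theorem fc_cell_apply_eq_zero_of_noSlowMate (hn : 0 < n) (h𝔸 : Torus.NearIso ((1 / (n:ℝ) ^ 2) • 𝔸) lo' hi') (hlo' : 0 < lo')
    (hU : Torus.IsPropagator Tw (cellField W M hM ν hν n) ((1 / (n:ℝ) ^ 2) • 𝔸) U) (x : V2)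
    (hx : ∀ k', (∃ ℓ₀ ∈ Torus.freqBall (d := Fin 3) (n / 4), ∀ i, (n : ℤ) ∣ k' i - ℓ₀ i) → fc x k' = 0)
    {s t : ℝ} (hs : 0 ≤ s) (hst : s ≤ t) (htT : t ≤ Tw) {k' : Fin 3 → ℤ}
    (hk' : ∃ ℓ₀ ∈ Torus.freqBall (d := Fin 3) (n / 4), ∀ i, (n : ℤ) ∣ k' i - ℓ₀ i) : fc (U s t x) k' = 0 := by
  classical
  haveI : Nonempty (Fin 3 → Fin n) := ⟨fun _ => ⟨0, hn⟩⟩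
  have hbU : MemLp (Torus.stLift (cellField W M hM ν hν n)) ∞ (volume.restrict (Ioo 0 Tw ×ˢ (univ : Set (EuclideanSpace ℝ (Fin 3))))) :=
    memLp_top_stLift_cell _ n Tw
  have hbUdiv : ∀ᵐ τ ∂(volume.restrict (Ioo (0:ℝ) Tw)), Torus.IsWeaklyDivFree (cellField W M hM ν hν n τ) :=
    ae_of_all _ fun τ => (isDivFree_cell _ n τ).isWeaklyDivFree_holds (isSmooth_cell _ n τ)
  have hgrid : ∀ (j : Fin 3 → Fin n) (τ : ℝ) (y : UnitAddTorus (Fin 3)),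
      cellField W M hM ν hν n τ (y + (fun i => ((((j i : ℕ) : ℝ) / n : ℝ) : UnitAddCircle))) = cellField W M hM ν hν n τ y :=
    fun j τ y => by unfold cellField; exact cell_add_grid _ hn j τ y
  refine hU.mFourierCoeff_apply_eq_zero_of_multiplier h𝔸 hlo' hbU hbUdiv
    (fun j : Fin 3 → Fin n => fun i => ((((j i : ℕ) : ℝ) / n : ℝ) : UnitAddCircle))
    (fun j => (if j = (fun _ => ⟨0, hn⟩) then (1:ℝ) else 0) -
        (1 / (n:ℝ) ^ 3 * ∑ ℓ₀ ∈ Torus.freqBall (d := Fin 3) (n / 4),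
          Real.cos (2 * Real.pi * (∑ i, (ℓ₀ i : ℝ) * ((j i : ℕ) : ℝ)) / n)))
    hgrid one_ne_zero x ?_ hs hst htT ?_
  · intro k'' hk''
    rw [noSlowMultiplier_eq hn k'']
    have : ¬ (∃ ℓ₀ ∈ Torus.freqBall (d := Fin 3) (n / 4), ∀ i, (n : ℤ) ∣ k'' i - ℓ₀ i) := fun h => hk'' (hx k'' h)
    rw [if_neg this]; norm_num
  · rw [noSlowMultiplier_eq hn k', if_pos hk']; norm_num

/-- **The cell propagator keeps data carried by classes WITH a slow mate inside those classes, at every time.** [folklore] -/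
theorem fc_cell_apply_eq_zero_of_slowMate (hn : 0 < n) (h𝔸 : Torus.NearIso ((1 / (n:ℝ) ^ 2) • 𝔸) lo' hi') (hlo' : 0 < lo')
    (hU : Torus.IsPropagator Tw (cellField W M hM ν hν n) ((1 / (n:ℝ) ^ 2) • 𝔸) U) (x : V2)
    (hx : ∀ k', ¬ (∃ ℓ₀ ∈ Torus.freqBall (d := Fin 3) (n / 4), ∀ i, (n : ℤ) ∣ k' i - ℓ₀ i) → fc x k' = 0)
    {s t : ℝ} (hs : 0 ≤ s) (hst : s ≤ t) (htT : t ≤ Tw) {k' : Fin 3 → ℤ}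
    (hk' : ¬ ∃ ℓ₀ ∈ Torus.freqBall (d := Fin 3) (n / 4), ∀ i, (n : ℤ) ∣ k' i - ℓ₀ i) : fc (U s t x) k' = 0 := by
  classical
  haveI : Nonempty (Fin 3 → Fin n) := ⟨fun _ => ⟨0, hn⟩⟩
  have hbU : MemLp (Torus.stLift (cellField W M hM ν hν n)) ∞ (volume.restrict (Ioo 0 Tw ×ˢ (univ : Set (EuclideanSpace ℝ (Fin 3))))) :=
    memLp_top_stLift_cell _ n Tw
  have hbUdiv : ∀ᵐ τ ∂(volume.restrict (Ioo (0:ℝ) Tw)), Torus.IsWeaklyDivFree (cellField W M hM ν hν n τ) :=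
    ae_of_all _ fun τ => (isDivFree_cell _ n τ).isWeaklyDivFree_holds (isSmooth_cell _ n τ)
  have hgrid : ∀ (j : Fin 3 → Fin n) (τ : ℝ) (y : UnitAddTorus (Fin 3)),
      cellField W M hM ν hν n τ (y + (fun i => ((((j i : ℕ) : ℝ) / n : ℝ) : UnitAddCircle))) = cellField W M hM ν hν n τ y :=
    fun j τ y => by unfold cellField; exact cell_add_grid _ hn j τ y
  refine hU.mFourierCoeff_apply_eq_zero_of_multiplier h𝔸 hlo' hbU hbUdiv
    (fun j : Fin 3 → Fin n => fun i => ((((j i : ℕ) : ℝ) / n : ℝ) : UnitAddCircle))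
    (fun j => 1 / (n:ℝ) ^ 3 * ∑ ℓ₀ ∈ Torus.freqBall (d := Fin 3) (n / 4),
          Real.cos (2 * Real.pi * (∑ i, (ℓ₀ i : ℝ) * ((j i : ℕ) : ℝ)) / n))
    hgrid one_ne_zero x ?_ hs hst htT ?_
  · intro k'' hk''
    rw [slowMultiplier_eq hn k'']
    have : (∃ ℓ₀ ∈ Torus.freqBall (d := Fin 3) (n / 4), ∀ i, (n : ℤ) ∣ k'' i - ℓ₀ i) := by
      by_contra h; exact hk'' (hx k'' h)
    rw [if_pos this]; norm_num
  · rw [slowMultiplier_eq hn k', if_neg hk']; norm_num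

/-! ## §3 Data carried by classes without a slow mate are damped by the cell propagator -/

/-- **MOLECULAR KILL OF THE FAST CLASSES.**  Data carried by Bloch classes WITHOUT a slow mate (every member outside `freqBall (n/4)`) are
damped by the cell propagator: `‖U s t x‖² ≤ exp(−8π²·lo′·⌊n/4⌋²·(t − s))·‖x‖²`, `lo′` the lower ellipticity constant of the cell tensor `(1/n²)•𝔸`.
[folklore] -/
theorem norm_sq_cell_apply_le_exp_of_noSlowMate (hn : 0 < n) (h𝔸 : Torus.NearIso ((1 / (n:ℝ) ^ 2) • 𝔸) lo' hi') (hlo' : 0 < lo')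
    (hU : Torus.IsPropagator Tw (cellField W M hM ν hν n) ((1 / (n:ℝ) ^ 2) • 𝔸) U) (x : V2)
    (hx : ∀ k', (∃ ℓ₀ ∈ Torus.freqBall (d := Fin 3) (n / 4), ∀ i, (n : ℤ) ∣ k' i - ℓ₀ i) → fc x k' = 0)
    {s t : ℝ} (hs : 0 ≤ s) (hst : s ≤ t) (htT : t ≤ Tw) :
    ‖U s t x‖ ^ 2 ≤ Real.exp (-(8 * Real.pi ^ 2 * lo' * ((n / 4 : ℕ) : ℝ) ^ 2 * (t - s))) * ‖x‖ ^ 2 := by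
  classical
  haveI : Nonempty (Fin 3 → Fin n) := ⟨fun _ => ⟨0, hn⟩⟩
  have hbU : MemLp (Torus.stLift (cellField W M hM ν hν n)) ∞ (volume.restrict (Ioo 0 Tw ×ˢ (univ : Set (EuclideanSpace ℝ (Fin 3))))) :=
    memLp_top_stLift_cell _ n Tw
  have hbUdiv : ∀ᵐ τ ∂(volume.restrict (Ioo (0:ℝ) Tw)), Torus.IsWeaklyDivFree (cellField W M hM ν hν n τ) :=
    ae_of_all _ fun τ => (isDivFree_cell _ n τ).isWeaklyDivFree_holds (isSmooth_cell _ n τ)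
  have hgrid : ∀ (j : Fin 3 → Fin n) (τ : ℝ) (y : UnitAddTorus (Fin 3)),
      cellField W M hM ν hν n τ (y + (fun i => ((((j i : ℕ) : ℝ) / n : ℝ) : UnitAddCircle))) = cellField W M hM ν hν n τ y :=
    fun j τ y => by unfold cellField; exact cell_add_grid _ hn j τ y
  refine hU.norm_sq_apply_le_exp_of_multiplier h𝔸 hlo' hbU hbUdiv
    (fun j : Fin 3 → Fin n => fun i => ((((j i : ℕ) : ℝ) / n : ℝ) : UnitAddCircle))
    (fun j => (if j = (fun _ => ⟨0, hn⟩) then (1:ℝ) else 0) -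
        (1 / (n:ℝ) ^ 3 * ∑ ℓ₀ ∈ Torus.freqBall (d := Fin 3) (n / 4),
          Real.cos (2 * Real.pi * (∑ i, (ℓ₀ i : ℝ) * ((j i : ℕ) : ℝ)) / n)))
    hgrid one_ne_zero (n / 4) ?_ x ?_ hs hst htT
  · intro k' hk'
    rw [noSlowMultiplier_eq hn k', if_pos (slowMate_of_mem_slowBall hk')]; norm_num
  · intro k'' hk''
    rw [noSlowMultiplier_eq hn k'']
    have : ¬ (∃ ℓ₀ ∈ Torus.freqBall (d := Fin 3) (n / 4), ∀ i, (n : ℤ) ∣ k'' i - ℓ₀ i) := fun h => hk'' (hx k'' h)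
    rw [if_neg this]; norm_num

end Cell

/-! ## §4 The (ff) pairing on data without a slow mate, in loss currency -/

/-- Loss currency: `(1 − E′)‖x‖² ≤ q` with `E′ < 1` gives `‖x‖ ≤ √(q / (1 − E′))`. [folklore] -/
theorem norm_le_sqrt_div_of_loss {x : V2} {E' q : ℝ} (hE' : E' < 1) (hq : (1 - E') * ‖x‖ ^ 2 ≤ q) :
    ‖x‖ ≤ Real.sqrt (q / (1 - E')) := by
  have h1E : 0 < 1 - E' := by linarith
  have hx : ‖x‖ ^ 2 ≤ q / (1 - E') := by rw [le_div_iff₀ h1E]; linarith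
  calc ‖x‖ = Real.sqrt (‖x‖ ^ 2) := (Real.sqrt_sq (norm_nonneg _)).symm
    _ ≤ Real.sqrt (q / (1 - E')) := Real.sqrt_le_sqrt hx

/-- **THE (ff) PAIRING ON FAST DATA WITHOUT A SLOW MATE, in loss currency.**  For the cell member `U` (carrier `cellField`, tensor `(1/n²)•𝔸` with
`NearIso lo′_U hi′_U`) and the coarse member `T` (no drift, tensor `𝔹` with `NearIso lo′_T hi′_T`), resolution `n ≥ 4`, a window
`0 ≤ s < t ≤ Tw`, a datum `x` carried by classes without a slow mate and a fast test `ζ` (`IsFast n ζ`):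
`|⟪U s t x − T s t x, ζ⟫| ≤ ((√E_U + √E_T)/(1 − E_T))·√(lossFwd (T s t) x)·√(lossAdj (T s t) ζ)`, `E_U = e^{−8π²lo′_U⌊n/4⌋²(t−s)}`,
`E_T = e^{−8π²lo′_T⌊n/4⌋²(t−s)}` (molecular kill of `U x` §3, modewise kill of `T x` and the two coarse losses from below, `…VmodCoarseLoss`). [folklore] -/
theorem ff_noSlowMate_pairing_le {k : ℕ} (W : LatticeShear.LatticeWord k) (M : ℝ) (hM : 0 < M) {ν : ℝ} (hν : 0 < ν) {n : ℕ} (hn4 : 4 ≤ n)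
    {𝔸 𝔹 : Torus.Visc4 (Fin 3)} {loU hiU loT hiT Tw : ℝ}
    (h𝔸 : Torus.NearIso ((1 / (n:ℝ) ^ 2) • 𝔸) loU hiU) (hloU : 0 < loU) (h𝔹 : Torus.NearIso 𝔹 loT hiT) (hloT : 0 < loT)
    {U T : ℝ → ℝ → (V2 →L[ℝ] V2)} (hU : Torus.IsPropagator Tw (cellField W M hM ν hν n) ((1 / (n:ℝ) ^ 2) • 𝔸) U)
    (hT : Torus.IsPropagator Tw (fun (_ : ℝ) (_ : UnitAddTorus (Fin 3)) => (0 : EuclideanSpace ℝ (Fin 3))) 𝔹 T)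
    {s t : ℝ} (hs : 0 ≤ s) (hst : s < t) (htT : t ≤ Tw) (x ζ : V2)
    (hx : ∀ k', (∃ ℓ₀ ∈ Torus.freqBall (d := Fin 3) (n / 4), ∀ i, (n : ℤ) ∣ k' i - ℓ₀ i) → fc x k' = 0) (hζ : IsFast n ζ) :
    |⟪U s t x - T s t x, ζ⟫_ℝ| ≤
      ((Real.sqrt (Real.exp (-(8 * Real.pi ^ 2 * loU * ((n / 4 : ℕ) : ℝ) ^ 2 * (t - s)))) +
          Real.sqrt (Real.exp (-(8 * Real.pi ^ 2 * loT * ((n / 4 : ℕ) : ℝ) ^ 2 * (t - s))))) /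
        (1 - Real.exp (-(8 * Real.pi ^ 2 * loT * ((n / 4 : ℕ) : ℝ) ^ 2 * (t - s))))) *
        Real.sqrt (lossFwd (T s t) x) * Real.sqrt (lossAdj (T s t) ζ) := by
  have hn : 0 < n := lt_of_lt_of_le (by norm_num) hn4
  set m : ℝ := ((n / 4 : ℕ) : ℝ) ^ 2 with hm
  have hm1 : 1 ≤ m := by
    have h14 : 1 ≤ n / 4 := (Nat.le_div_iff_mul_le (by norm_num)).2 (by omega)
    have : (1 : ℝ) ≤ ((n / 4 : ℕ) : ℝ) := by exact_mod_cast h14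
    rw [hm]; nlinarith
  have hm0 : 0 ≤ m := by linarith
  set EU : ℝ := Real.exp (-(8 * Real.pi ^ 2 * loU * m * (t - s))) with hEU
  set ET : ℝ := Real.exp (-(8 * Real.pi ^ 2 * loT * m * (t - s))) with hET
  have hEU0 : 0 ≤ EU := (Real.exp_pos _).le
  have hET0 : 0 ≤ ET := (Real.exp_pos _).le
  have hET1 : ET < 1 := by
    rw [hET, Real.exp_lt_one_iff]
    have hts : 0 < t - s := sub_pos.2 hst
    have : 0 < 8 * Real.pi ^ 2 * loT * m * (t - s) := by positivity
    linarith
  have h1ET : 0 < 1 - ET := by linarith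
  -- `x` and `ζ` are fast: every mode of theirs is outside the slow ball
  have hxfast : ∀ k', fc x k' ≠ 0 → m ≤ Torus.freqNormSq k' := by
    intro k' hk'
    have hk'ball : k' ∉ Torus.freqBall (d := Fin 3) (n / 4) := fun h => hk' (hx k' (slowMate_of_mem_slowBall h))
    exact (Torus.not_mem_freqBall.1 hk'ball).le
  have hζfast : ∀ k', fc ζ k' ≠ 0 → m ≤ Torus.freqNormSq k' := by
    intro k' hk'
    have hk'ball : k' ∉ Torus.freqBall (d := Fin 3) (n / 4) := fun h => hk' (hζ k' h)
    exact (Torus.not_mem_freqBall.1 hk'ball).le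
  -- the four energy facts
  have hUx : ‖U s t x‖ ^ 2 ≤ EU * ‖x‖ ^ 2 := norm_sq_cell_apply_le_exp_of_noSlowMate W M hM hν hn h𝔸 hloU hU x hx hs hst.le htT
  have hTx : ‖T s t x‖ ^ 2 ≤ ET * ‖x‖ ^ 2 := norm_sq_apply_le_exp_of_supp h𝔹 hloT (fun _ _ => rfl) hT hs hst.le htT x hm0 hxfast
  have hqx : (1 - ET) * ‖x‖ ^ 2 ≤ lossFwd (T s t) x := lossFwd_ge_of_supp h𝔹 hloT (fun _ _ => rfl) hT hs hst.le htT x hm0 hxfast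
  have hqζ : (1 - ET) * ‖ζ‖ ^ 2 ≤ lossAdj (T s t) ζ := lossAdj_ge_of_supp h𝔹 hloT hT hs hst.le htT ζ hm0 hζfast
  have hx' : ‖x‖ ≤ Real.sqrt (lossFwd (T s t) x / (1 - ET)) := norm_le_sqrt_div_of_loss hET1 hqx
  have hζ' : ‖ζ‖ ≤ Real.sqrt (lossAdj (T s t) ζ / (1 - ET)) := norm_le_sqrt_div_of_loss hET1 hqζ
  have hq0 : 0 ≤ lossFwd (T s t) x := le_trans (mul_nonneg h1ET.le (sq_nonneg _)) hqx
  have hqζ0 : 0 ≤ lossAdj (T s t) ζ := le_trans (mul_nonneg h1ET.le (sq_nonneg _)) hqζ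
  -- norms of the two members
  have hUx' : ‖U s t x‖ ≤ Real.sqrt EU * ‖x‖ := by
    calc ‖U s t x‖ = Real.sqrt (‖U s t x‖ ^ 2) := (Real.sqrt_sq (norm_nonneg _)).symm
      _ ≤ Real.sqrt (EU * ‖x‖ ^ 2) := Real.sqrt_le_sqrt hUx
      _ = Real.sqrt EU * ‖x‖ := by rw [Real.sqrt_mul hEU0, Real.sqrt_sq (norm_nonneg _)]
  have hTx' : ‖T s t x‖ ≤ Real.sqrt ET * ‖x‖ := by
    calc ‖T s t x‖ = Real.sqrt (‖T s t x‖ ^ 2) := (Real.sqrt_sq (norm_nonneg _)).symm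
      _ ≤ Real.sqrt (ET * ‖x‖ ^ 2) := Real.sqrt_le_sqrt hTx
      _ = Real.sqrt ET * ‖x‖ := by rw [Real.sqrt_mul hET0, Real.sqrt_sq (norm_nonneg _)]
  -- assemble
  have hpair : |⟪U s t x - T s t x, ζ⟫_ℝ| ≤ (Real.sqrt EU + Real.sqrt ET) * ‖x‖ * ‖ζ‖ := by
    calc |⟪U s t x - T s t x, ζ⟫_ℝ| ≤ ‖U s t x - T s t x‖ * ‖ζ‖ := abs_real_inner_le_norm _ _
      _ ≤ (‖U s t x‖ + ‖T s t x‖) * ‖ζ‖ := mul_le_mul_of_nonneg_right (norm_sub_le _ _) (norm_nonneg _)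
      _ ≤ (Real.sqrt EU * ‖x‖ + Real.sqrt ET * ‖x‖) * ‖ζ‖ := mul_le_mul_of_nonneg_right (add_le_add hUx' hTx') (norm_nonneg _)
      _ = (Real.sqrt EU + Real.sqrt ET) * ‖x‖ * ‖ζ‖ := by ring
  have hcoef : 0 ≤ Real.sqrt EU + Real.sqrt ET := add_nonneg (Real.sqrt_nonneg _) (Real.sqrt_nonneg _)
  have hsq : Real.sqrt (lossFwd (T s t) x / (1 - ET)) * Real.sqrt (lossAdj (T s t) ζ / (1 - ET)) =
      Real.sqrt (lossFwd (T s t) x) * Real.sqrt (lossAdj (T s t) ζ) / (1 - ET) := by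
    rw [Real.sqrt_div hq0, Real.sqrt_div hqζ0, div_mul_div_comm, Real.mul_self_sqrt h1ET.le]
  calc |⟪U s t x - T s t x, ζ⟫_ℝ| ≤ (Real.sqrt EU + Real.sqrt ET) * ‖x‖ * ‖ζ‖ := hpair
    _ ≤ (Real.sqrt EU + Real.sqrt ET) * Real.sqrt (lossFwd (T s t) x / (1 - ET)) * Real.sqrt (lossAdj (T s t) ζ / (1 - ET)) := by
        have h1 : (Real.sqrt EU + Real.sqrt ET) * ‖x‖ ≤ (Real.sqrt EU + Real.sqrt ET) * Real.sqrt (lossFwd (T s t) x / (1 - ET)) :=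
          mul_le_mul_of_nonneg_left hx' hcoef
        exact mul_le_mul h1 hζ' (norm_nonneg _) (mul_nonneg hcoef (Real.sqrt_nonneg _))
    _ = (Real.sqrt EU + Real.sqrt ET) / (1 - ET) * Real.sqrt (lossFwd (T s t) x) * Real.sqrt (lossAdj (T s t) ζ) := by
        rw [mul_assoc, hsq]; ring

end Summit.AnomalousDissipation.AnomalousDissipation.Theorems.SolenoidalFractalHomogenisation.LagrangianStep.VmodFlat

end
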